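import Literature.Probability.Percolation.SlabRSWSnapFrame
import HarnessLib

/-!
# Newman–Tassion–Wu 2017, Lemma 3.16 — the free part of a frame: rectangle, quadrant or L-shape

Topic: `Literature/Probability/Percolation`. Third file of the coarse-grained gluing datum. For a
frame `(B = [x₁,x₂]×[y₁,y₂], X, Y)` of a point `p` (`SlabRSWSnapFrame.lean`) and a union `U` of
lattice tiles with `p ∉ U`, the part of `B` free of `U` around `p` has one of five shapes
(`Layout`), each recorded with exactly the data the local surgery needs (a routing rectangle or
cross of width `≥ 3`/height `≥ 4`, the cells of `U` bordering it — the "ports" through which a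
branch reaches a far path arriving inside `U` —, and where `p` sits):

* `clear` — no tile meets `B`;
* `halfV s` / `halfH s` — the free part is the open half-box on the side `s ∈ {±1}` of the line
  `x = X` (resp. `y = Y`), and the whole line inside `B` belongs to `U`;
* `quad sx sy` — the free part around `p` is the open quadrant `{sx (x - X) > 0, sy (y - Y) > 0}`,
  and the two half-lines of `x = X`, `y = Y` bounding its closure belong to `U` (this includes the
  "checkerboard", where the opposite open quadrant is free as well but out of reach);
* `ell sx sy` — `U ∩ B` is exactly the closed quadrant `{sx (x - X) ≥ 0, sy (y - Y) ≥ 0} ∩ B`,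
  the free part is the L-shaped complement.

`layout_of_frame` proves the classification from the trace property of tiles on a frame. All side
conditions are written as linear disjunctions (`Side`, `SideW`) so that `omega` handles the signs.

## Sources

* C. M. Newman, V. Tassion, W. Wu, *Critical percolation and the minimal spanning tree in slabs*,
  Comm. Pure Appl. Math. 70 (2017), arXiv:1512.09107: §3.5, proof of Lemma 3.16 ("the domain `K_□`
  is regular enough to apply Theorem 3.6"), Remark 2 after Theorem 3.7 [NewmanTassionWu2017].
-/

noncomputable section

namespace Literature.Probability.Percolation

open MeasureTheory LatticeModels SimpleGraph

namespace NTW17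

/-! ## Signed sides of a line, in linear form -/

/-- `t` is strictly on the side `s ∈ {±1}` of `X`: `s = 1 ∧ X < t` or `s = -1 ∧ t < X`.
[cite: NewmanTassionWu2017, §3.5 (proof of Lemma 3.16)] -/
def Side (s X t : ℤ) : Prop := (s = 1 ∧ X < t) ∨ (s = -1 ∧ t < X)

/-- `t` is weakly on the side `s ∈ {±1}` of `X`: `s = 1 ∧ X ≤ t` or `s = -1 ∧ t ≤ X`.
[cite: NewmanTassionWu2017, §3.5 (proof of Lemma 3.16)] -/
def SideW (s X t : ℤ) : Prop := (s = 1 ∧ X ≤ t) ∨ (s = -1 ∧ t ≤ X)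

/-! ## The five layouts -/

/-- **The layout of a tile union `U` on a frame around a free point `p`.** See the module docstring.
[cite: NewmanTassionWu2017, §3.5 (proof of Lemma 3.16, "K_□ … regular enough")] -/
inductive Layout (x₁ x₂ y₁ y₂ X Y : ℤ) (U : Set (ℤ × ℤ)) (p : ℤ × ℤ) : Prop
  /-- no tile meets the box -/
  | clear (h : ∀ z ∈ boxR x₁ x₂ y₁ y₂, z ∉ U)
  /-- free open half-box on the side `s` of the vertical line `x = X`; `U ∩ B` is the closed other half -/
  | halfV (s a b : ℤ) (hs : s = 1 ∨ s = -1)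
      (hK : ∀ x : ℤ, (a ≤ x ∧ x ≤ b) ↔ (x₁ ≤ x ∧ x ≤ x₂ ∧ Side s X x)) (hab : a + 3 ≤ b)
      (hXr : x₁ + 4 ≤ X ∧ X + 4 ≤ x₂) (hp : Side s X p.1)
      (hU : ∀ z ∈ boxR x₁ x₂ y₁ y₂, z ∈ U ↔ SideW (-s) X z.1)
  /-- free open half-box on the side `s` of the horizontal line `y = Y`; `U ∩ B` is the closed other half -/
  | halfH (s c d : ℤ) (hs : s = 1 ∨ s = -1)
      (hK : ∀ y : ℤ, (c ≤ y ∧ y ≤ d) ↔ (y₁ ≤ y ∧ y ≤ y₂ ∧ Side s Y y)) (hcd : c + 3 ≤ d)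
      (hYr : y₁ + 4 ≤ Y ∧ Y + 4 ≤ y₂) (hp : Side s Y p.2)
      (hU : ∀ z ∈ boxR x₁ x₂ y₁ y₂, z ∈ U ↔ SideW (-s) Y z.2)
  /-- free open quadrant `{sx(x-X) > 0, sy(y-Y) > 0}` around `p`; the two closed quadrants adjacent
  to it across the lines are in `U` -/
  | quad (sx sy a b c d : ℤ) (hsx : sx = 1 ∨ sx = -1) (hsy : sy = 1 ∨ sy = -1)
      (hKx : ∀ x : ℤ, (a ≤ x ∧ x ≤ b) ↔ (x₁ ≤ x ∧ x ≤ x₂ ∧ Side sx X x))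
      (hKy : ∀ y : ℤ, (c ≤ y ∧ y ≤ d) ↔ (y₁ ≤ y ∧ y ≤ y₂ ∧ Side sy Y y))
      (hab : a + 3 ≤ b) (hcd : c + 3 ≤ d) (hXr : x₁ + 4 ≤ X ∧ X + 4 ≤ x₂) (hYr : y₁ + 4 ≤ Y ∧ Y + 4 ≤ y₂)
      (hp : Side sx X p.1 ∧ Side sy Y p.2)
      (hfree : ∀ z ∈ boxR x₁ x₂ y₁ y₂, Side sx X z.1 → Side sy Y z.2 → z ∉ U)
      (hUV : ∀ z ∈ boxR x₁ x₂ y₁ y₂, SideW (-sx) X z.1 → SideW sy Y z.2 → z ∈ U)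
      (hUH : ∀ z ∈ boxR x₁ x₂ y₁ y₂, SideW sx X z.1 → SideW (-sy) Y z.2 → z ∈ U)
  /-- `U ∩ B` is the closed quadrant `{sx(x-X) ≥ 0, sy(y-Y) ≥ 0} ∩ B`; the free part is the L around it,
  whose two bars meet in the block `[a,b]×[c,d]` -/
  | ell (sx sy a b c d : ℤ) (hsx : sx = 1 ∨ sx = -1) (hsy : sy = 1 ∨ sy = -1)
      (hKx : ∀ x : ℤ, (a ≤ x ∧ x ≤ b) ↔ (x₁ ≤ x ∧ x ≤ x₂ ∧ Side (-sx) X x))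
      (hKy : ∀ y : ℤ, (c ≤ y ∧ y ≤ d) ↔ (y₁ ≤ y ∧ y ≤ y₂ ∧ Side (-sy) Y y))
      (hab : a + 2 ≤ b) (hcd : c + 3 ≤ d) (hXr : x₁ + 4 ≤ X ∧ X + 4 ≤ x₂) (hYr : y₁ + 4 ≤ Y ∧ Y + 4 ≤ y₂)
      (hU : ∀ z ∈ boxR x₁ x₂ y₁ y₂, z ∈ U ↔ (SideW sx X z.1 ∧ SideW sy Y z.2))
      (hp : Side (-sx) X p.1 ∨ Side (-sy) Y p.2)

/-! ## The classification -/

section Classify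

variable {n : ℕ} {p : ℤ × ℤ} {x₁ x₂ y₁ y₂ X Y : ℤ} {C : Set (ℤ × ℤ)}

/-- **The trace of a tile through a given cell, in interval form.** For a cell `w` of a lattice
tile inside the frame box: the tile meets the box in `[lo,hi]×[lo',hi']` with
`(lo,hi) ∈ {(x₁,x₂), (x₁,X), (X,x₂)}` (the last two only for a real line `x₁ ≤ X`), likewise
vertically; every cell of that rectangle is in the tile union; `w` is in it.
[cite: NewmanTassionWu2017, §3.5 (proof of Lemma 3.16, "K_□ … regular enough")] -/
theorem tile_trace_int (hF : IsFrame n p x₁ x₂ y₁ y₂ X Y) (hW : IsFrameND n x₁ x₂ y₁ X Y)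
    (hC : ∀ c ∈ C, LatCentre n c) {w : ℤ × ℤ} (hw : w ∈ tileUnion C) (hwB : w ∈ boxR x₁ x₂ y₁ y₂) :
    ∃ lo hi lo' hi' : ℤ,
      ((lo = x₁ ∧ hi = x₂) ∨ (lo = x₁ ∧ hi = X ∧ x₁ + 4 ≤ X ∧ X + 4 ≤ x₂) ∨ (lo = X ∧ hi = x₂ ∧ x₁ + 4 ≤ X ∧ X + 4 ≤ x₂)) ∧
      ((lo' = y₁ ∧ hi' = y₂) ∨ (lo' = y₁ ∧ hi' = Y ∧ y₁ + 4 ≤ Y ∧ Y + 4 ≤ y₂) ∨ (lo' = Y ∧ hi' = y₂ ∧ y₁ + 4 ≤ Y ∧ Y + 4 ≤ y₂)) ∧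
      (∀ z : ℤ × ℤ, lo ≤ z.1 → z.1 ≤ hi → lo' ≤ z.2 → z.2 ≤ hi' → x₁ ≤ z.1 → z.1 ≤ x₂ → y₁ ≤ z.2 →
        z.2 ≤ y₂ → z ∈ tileUnion C) ∧
      (lo ≤ w.1 ∧ w.1 ≤ hi ∧ lo' ≤ w.2 ∧ w.2 ≤ hi') := by
  obtain ⟨c, hc, hwc⟩ := hw
  obtain ⟨hc1, hc2, hcb1, hcb2, hcb3⟩ := hC c hc
  rw [mem_sqBox_iff'] at hwc
  rw [mem_boxR_iff] at hwB
  push_cast at hwc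
  have hXle := hF.hXle
  have hYle := hF.hYle
  have hbx₁ := hF.hbx₁; have hbx₂ := hF.hbx₂; have hby₁ := hF.hby₁; have hby₂ := hF.hby₂
  have hpx₁ := hF.hpx₁; have hpx₂ := hF.hpx₂; have hpy₁ := hF.hpy₁; have hpy₂ := hF.hpy₂
  have hx : ∃ lo hi : ℤ, ((lo = x₁ ∧ hi = x₂) ∨ (lo = x₁ ∧ hi = X ∧ x₁ + 4 ≤ X ∧ X + 4 ≤ x₂) ∨
        (lo = X ∧ hi = x₂ ∧ x₁ + 4 ≤ X ∧ X + 4 ≤ x₂)) ∧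
      (∀ t : ℤ, lo ≤ t → t ≤ hi → x₁ ≤ t → t ≤ x₂ → (c.1 - 40 ≤ t ∧ t ≤ c.1 + 40)) ∧ lo ≤ w.1 ∧ w.1 ≤ hi := by
    rcases hF.htx_nd hW hc1 hcb1 hcb2 with h | h | ⟨h, hr, hr'⟩ | ⟨h, hr, hr'⟩
    · exfalso; omega
    · exact ⟨x₁, x₂, Or.inl ⟨rfl, rfl⟩, fun t _ _ h3 h4 => by omega, hwB.1, hwB.2.1⟩
    · exact ⟨x₁, X, Or.inr (Or.inl ⟨rfl, rfl, hr, hr'⟩), fun t _ h2 h3 _ => by omega, hwB.1, by omega⟩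
    · exact ⟨X, x₂, Or.inr (Or.inr ⟨rfl, rfl, hr, hr'⟩), fun t h1 _ _ h4 => by omega, by omega, hwB.2.1⟩
  have hy : ∃ lo hi : ℤ, ((lo = y₁ ∧ hi = y₂) ∨ (lo = y₁ ∧ hi = Y ∧ y₁ + 4 ≤ Y ∧ Y + 4 ≤ y₂) ∨
        (lo = Y ∧ hi = y₂ ∧ y₁ + 4 ≤ Y ∧ Y + 4 ≤ y₂)) ∧
      (∀ t : ℤ, lo ≤ t → t ≤ hi → y₁ ≤ t → t ≤ y₂ → (c.2 - 40 ≤ t ∧ t ≤ c.2 + 40)) ∧ lo ≤ w.2 ∧ w.2 ≤ hi := by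
    rcases hF.hty_nd hW hc2 hcb3 with h | h | ⟨h, hr, hr'⟩ | ⟨h, hr, hr'⟩
    · exfalso; omega
    · exact ⟨y₁, y₂, Or.inl ⟨rfl, rfl⟩, fun t _ _ h3 h4 => by omega, hwB.2.2.1, hwB.2.2.2⟩
    · exact ⟨y₁, Y, Or.inr (Or.inl ⟨rfl, rfl, hr, hr'⟩), fun t _ h2 h3 _ => by omega, hwB.2.2.1, by omega⟩
    · exact ⟨Y, y₂, Or.inr (Or.inr ⟨rfl, rfl, hr, hr'⟩), fun t h1 _ _ h4 => by omega, by omega, hwB.2.2.2⟩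
  obtain ⟨lo, hi, hlh, hxt, hw1, hw2⟩ := hx
  obtain ⟨lo', hi', hlh', hyt, hw3, hw4⟩ := hy
  refine ⟨lo, hi, lo', hi', hlh, hlh', fun z h1 h2 h3 h4 h5 h6 h7 h8 => ?_, hw1, hw2, hw3, hw4⟩
  refine ⟨c, hc, ?_⟩
  rw [mem_sqBox_iff']
  have := hxt z.1 h1 h2 h5 h6
  have := hyt z.2 h3 h4 h7 h8
  push_cast
  omega

/-- The trace of the tile through a cell of `U ∩ B` misses `p` (common prelude of the position
lemmas). [cite: NewmanTassionWu2017, §3.5 (proof of Lemma 3.16)] -/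
theorem layout_key (hF : IsFrame n p x₁ x₂ y₁ y₂ X Y) (hW : IsFrameND n x₁ x₂ y₁ X Y)
    (hC : ∀ c ∈ C, LatCentre n c) (hpU : p ∉ tileUnion C) :
    ∀ w : ℤ × ℤ, w ∈ tileUnion C → w ∈ boxR x₁ x₂ y₁ y₂ → ∃ lo hi lo' hi' : ℤ,
      ((lo = x₁ ∧ hi = x₂) ∨ (lo = x₁ ∧ hi = X ∧ x₁ + 4 ≤ X ∧ X + 4 ≤ x₂) ∨ (lo = X ∧ hi = x₂ ∧ x₁ + 4 ≤ X ∧ X + 4 ≤ x₂)) ∧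
      ((lo' = y₁ ∧ hi' = y₂) ∨ (lo' = y₁ ∧ hi' = Y ∧ y₁ + 4 ≤ Y ∧ Y + 4 ≤ y₂) ∨ (lo' = Y ∧ hi' = y₂ ∧ y₁ + 4 ≤ Y ∧ Y + 4 ≤ y₂)) ∧
      (∀ z : ℤ × ℤ, lo ≤ z.1 → z.1 ≤ hi → lo' ≤ z.2 → z.2 ≤ hi' → x₁ ≤ z.1 → z.1 ≤ x₂ → y₁ ≤ z.2 →
        z.2 ≤ y₂ → z ∈ tileUnion C) ∧
      (lo ≤ w.1 ∧ w.1 ≤ hi ∧ lo' ≤ w.2 ∧ w.2 ≤ hi') ∧ ¬(lo ≤ p.1 ∧ p.1 ≤ hi ∧ lo' ≤ p.2 ∧ p.2 ≤ hi') := by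
  intro w hwU hwB
  obtain ⟨lo, hi, lo', hi', h1, h2, h3, h4⟩ := tile_trace_int hF hW hC hwU hwB
  refine ⟨lo, hi, lo', hi', h1, h2, h3, h4, fun hp => hpU ?_⟩
  exact h3 p hp.1 hp.2.1 hp.2.2.1 hp.2.2.2 hF.hpx₁ hF.hpx₂ hF.hpy₁ hF.hpy₂

/-- Position `SW` of `p` (position SW: `p.1 < X`, `p.2 < Y`; a tile missing `p` has `lo = X` or `lo' = Y`). [cite: NewmanTassionWu2017, §3.5 (proof of Lemma 3.16)] -/
theorem layout_SW (hF : IsFrame n p x₁ x₂ y₁ y₂ X Y) (hW : IsFrameND n x₁ x₂ y₁ X Y)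
    (hC : ∀ c ∈ C, LatCentre n c) (hpU : p ∉ tileUnion C) (hpx : p.1 < X) (hpy : p.2 < Y) :
    Layout x₁ x₂ y₁ y₂ X Y (tileUnion C) p := by
  set U := tileUnion C with hU
  set B := boxR x₁ x₂ y₁ y₂ with hBdef
  have hFc := hF
  obtain ⟨fx₁, fx₂, fy₁, fy₂, fpx₁, fpx₂, fpy₁, fpy₂, fbx₁, fbx₂, fby₁, fby₂, fdx₁, fdx₂, fdy₁, fdy₂, hX, hY,
    hXle, hYle, -, -⟩ := hFc
  have hwx : x₁ + 8 ≤ x₂ := by omega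
  have hwy : y₁ + 8 ≤ y₂ := by omega
  have key := layout_key hF hW hC hpU
  have memB : ∀ z : ℤ × ℤ, z ∈ B ↔ x₁ ≤ z.1 ∧ z.1 ≤ x₂ ∧ y₁ ≤ z.2 ∧ z.2 ≤ y₂ := fun z => by
    rw [hBdef, mem_boxR_iff]
  have mk : ∀ {lo hi lo' hi' : ℤ},
      (∀ z : ℤ × ℤ, lo ≤ z.1 → z.1 ≤ hi → lo' ≤ z.2 → z.2 ≤ hi' → x₁ ≤ z.1 → z.1 ≤ x₂ → y₁ ≤ z.2 →
        z.2 ≤ y₂ → z ∈ U) →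
      ∀ a b : ℤ, lo ≤ a → a ≤ hi → lo' ≤ b → b ≤ hi' → x₁ ≤ a → a ≤ x₂ → y₁ ≤ b → b ≤ y₂ →
        ((a, b) ∈ U ∧ (a, b) ∈ B) := by
    intro lo hi lo' hi' h a b h1 h2 h3 h4 h5 h6 h7 h8
    exact ⟨h (a, b) h1 h2 h3 h4 h5 h6 h7 h8, (memB _).2 ⟨h5, h6, h7, h8⟩⟩
  by_cases hBe : ∃ w ∈ U, w ∈ B ∧ w.2 < Y
  · obtain ⟨w, hwU, hwB, hwc⟩ := hBe
    obtain ⟨lo, hi, lo', hi', hxT, hyT, hcov, hwin, hnp⟩ := key w hwU hwB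
    rw [memB] at hwB
    by_cases hLe : ∃ w ∈ U, w ∈ B ∧ w.1 < X
    · obtain ⟨v, hvU, hvB, hvc⟩ := hLe
      obtain ⟨lo₂, hi₂, lo₂', hi₂', hxT₂, hyT₂, hcov₂, hvin, hnp₂⟩ := key v hvU hvB
      rw [memB] at hvB
      refine Layout.quad (-1) (-1) x₁ (X - 1) y₁ (Y - 1) (Or.inr rfl) (Or.inr rfl)
        (fun x => by unfold Side; omega) (fun y => by unfold Side; omega) (by omega) (by omega)
        ⟨by omega, by omega⟩ ⟨by omega, by omega⟩ ⟨by unfold Side; omega, by unfold Side; omega⟩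
        (fun z hz h1 h2 hzU => ?_) (fun z hz h1 h2 => ?_) (fun z hz h1 h2 => ?_)
      · obtain ⟨lo₃, hi₃, lo₃', hi₃', hxT₃, hyT₃, -, hzin, hnp₃⟩ := key z hzU hz
        rw [memB] at hz; unfold Side at h1 h2; omega
      · rw [memB] at hz; unfold SideW at h1 h2
        exact hcov z (by omega) (by omega) (by omega) (by omega) hz.1 hz.2.1 hz.2.2.1 hz.2.2.2
      · rw [memB] at hz; unfold SideW at h1 h2
        exact hcov₂ z (by omega) (by omega) (by omega) (by omega) hz.1 hz.2.1 hz.2.2.1 hz.2.2.2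
    · push Not at hLe
      have hc := mk hcov lo w.2 le_rfl (by omega) (by omega) (by omega) (by omega) (by omega) (by omega) (by omega)
      have hlo := hLe _ hc.1 hc.2
      simp only at hlo
      by_cases hAb : ∃ w ∈ U, w ∈ B ∧ Y < w.2
      · obtain ⟨v, hvU, hvB, hvc⟩ := hAb
        obtain ⟨lo₂, hi₂, lo₂', hi₂', hxT₂, hyT₂, hcov₂, hvin, hnp₂⟩ := key v hvU hvB
        rw [memB] at hvB
        have hc₂ := mk hcov₂ lo₂ v.2 le_rfl (by omega) (by omega) (by omega) (by omega) (by omega) (by omega)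
          (by omega)
        have hlo₂ := hLe _ hc₂.1 hc₂.2
        simp only at hlo₂
        refine Layout.halfV (-1) x₁ (X - 1) (Or.inr rfl) (fun x => by unfold Side; omega) (by omega)
          ⟨by omega, by omega⟩ (by unfold Side; omega) (fun z hz => ⟨fun hzU => ?_, fun h1 => ?_⟩)
        · have := hLe z hzU hz; unfold SideW; omega
        · unfold SideW at h1; rw [memB] at hz
          by_cases hzY : z.2 ≤ Y
          · exact hcov z (by omega) (by omega) (by omega) (by omega) hz.1 hz.2.1 hz.2.2.1 hz.2.2.2
          · exact hcov₂ z (by omega) (by omega) (by omega) (by omega) hz.1 hz.2.1 hz.2.2.1 hz.2.2.2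
      · push Not at hAb
        have hc' := mk hcov w.1 hi' (by omega) (by omega) (by omega) le_rfl (by omega) (by omega) (by omega)
          (by omega)
        have hhi := hAb _ hc'.1 hc'.2
        simp only at hhi
        refine Layout.ell 1 (-1) x₁ (X - 1) (Y + 1) y₂ (Or.inl rfl) (Or.inr rfl)
          (fun x => by unfold Side; omega) (fun y => by unfold Side; omega) (by omega) (by omega)
          ⟨by omega, by omega⟩ ⟨by omega, by omega⟩ (fun z hz => ?_) (Or.inl (by unfold Side; omega))
        have hz' := (memB z).1 hz
        unfold SideW
        constructor
        · intro hzU; have := hLe z hzU hz; have := hAb z hzU hz; omega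
        · intro h
          exact hcov z (by omega) (by omega) (by omega) (by omega) hz'.1 hz'.2.1 hz'.2.2.1 hz'.2.2.2
  · push Not at hBe
    by_cases hLe : ∃ w ∈ U, w ∈ B ∧ w.1 < X
    · obtain ⟨v, hvU, hvB, hvc⟩ := hLe
      obtain ⟨lo₂, hi₂, lo₂', hi₂', hxT₂, hyT₂, hcov₂, hvin, hnp₂⟩ := key v hvU hvB
      rw [memB] at hvB
      by_cases hRi : ∃ w ∈ U, w ∈ B ∧ X < w.1
      · obtain ⟨u, huU, huB, huc⟩ := hRi
        obtain ⟨lo₃, hi₃, lo₃', hi₃', hxT₃, hyT₃, hcov₃, huin, hnp₃⟩ := key u huU huB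
        rw [memB] at huB
        have hc₃ := mk hcov₃ u.1 lo₃' (by omega) (by omega) le_rfl (by omega) (by omega) (by omega) (by omega)
          (by omega)
        have hlo₃ := hBe _ hc₃.1 hc₃.2
        simp only at hlo₃
        refine Layout.halfH (-1) y₁ (Y - 1) (Or.inr rfl) (fun y => by unfold Side; omega) (by omega)
          ⟨by omega, by omega⟩ (by unfold Side; omega) (fun z hz => ⟨fun hzU => ?_, fun h1 => ?_⟩)
        · have := hBe z hzU hz; unfold SideW; omega
        · unfold SideW at h1; rw [memB] at hz
          by_cases hzX : z.1 ≤ X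
          · exact hcov₂ z (by omega) (by omega) (by omega) (by omega) hz.1 hz.2.1 hz.2.2.1 hz.2.2.2
          · exact hcov₃ z (by omega) (by omega) (by omega) (by omega) hz.1 hz.2.1 hz.2.2.1 hz.2.2.2
      · push Not at hRi
        by_cases hX4 : X + 4 ≤ x₂
        · refine Layout.ell (-1) 1 (X + 1) x₂ y₁ (Y - 1) (Or.inr rfl) (Or.inl rfl)
            (fun x => by unfold Side; omega) (fun y => by unfold Side; omega) (by omega) (by omega)
            ⟨by omega, by omega⟩ ⟨by omega, by omega⟩ (fun z hz => ?_) (Or.inr (by unfold Side; omega))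
          have hz' := (memB z).1 hz
          unfold SideW
          constructor
          · intro hzU; have := hRi z hzU hz; have := hBe z hzU hz; omega
          · intro h
            exact hcov₂ z (by omega) (by omega) (by omega) (by omega) hz'.1 hz'.2.1 hz'.2.2.1 hz'.2.2.2
        · refine Layout.halfH (-1) y₁ (Y - 1) (Or.inr rfl) (fun y => by unfold Side; omega) (by omega)
            ⟨by omega, by omega⟩ (by unfold Side; omega) (fun z hz => ⟨fun hzU => ?_, fun h1 => ?_⟩)
          · have := hBe z hzU hz; unfold SideW; omega
          · unfold SideW at h1; rw [memB] at hz
            exact hcov₂ z (by omega) (by omega) (by omega) (by omega) hz.1 hz.2.1 hz.2.2.1 hz.2.2.2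
    · push Not at hLe
      by_cases hne : ∃ w ∈ U, w ∈ B
      · obtain ⟨w, hwU, hwB⟩ := hne
        obtain ⟨lo, hi, lo', hi', hxT, hyT, hcov, hwin, hnp⟩ := key w hwU hwB
        rw [memB] at hwB
        have hc := mk hcov lo w.2 le_rfl (by omega) (by omega) (by omega) (by omega) (by omega) (by omega)
          (by omega)
        have hlo := hLe _ hc.1 hc.2
        have hc' := mk hcov w.1 lo' (by omega) (by omega) le_rfl (by omega) (by omega) (by omega) (by omega)
          (by omega)
        have hlo' := hBe _ hc'.1 hc'.2
        simp only at hlo hlo'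
        refine Layout.ell 1 1 x₁ (X - 1) y₁ (Y - 1) (Or.inl rfl) (Or.inl rfl)
          (fun x => by unfold Side; omega) (fun y => by unfold Side; omega) (by omega) (by omega)
          ⟨by omega, by omega⟩ ⟨by omega, by omega⟩ (fun z hz => ?_) (Or.inl (by unfold Side; omega))
        have hz' := (memB z).1 hz
        unfold SideW
        constructor
        · intro hzU; have := hLe z hzU hz; have := hBe z hzU hz; omega
        · intro h
          exact hcov z (by omega) (by omega) (by omega) (by omega) hz'.1 hz'.2.1 hz'.2.2.1 hz'.2.2.2
      · push Not at hne
        exact Layout.clear fun z hz hzU => hne z hzU hz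

/-- Position `W` of `p` (position W: `p.1 < X`, `p.2 = Y`; a tile missing `p` has `lo = X`). [cite: NewmanTassionWu2017, §3.5 (proof of Lemma 3.16)] -/
theorem layout_W (hF : IsFrame n p x₁ x₂ y₁ y₂ X Y) (hW : IsFrameND n x₁ x₂ y₁ X Y)
    (hC : ∀ c ∈ C, LatCentre n c) (hpU : p ∉ tileUnion C) (hpx : p.1 < X) (hpy : p.2 = Y) :
    Layout x₁ x₂ y₁ y₂ X Y (tileUnion C) p := by
  set U := tileUnion C with hU
  set B := boxR x₁ x₂ y₁ y₂ with hBdef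
  have hFc := hF
  obtain ⟨fx₁, fx₂, fy₁, fy₂, fpx₁, fpx₂, fpy₁, fpy₂, fbx₁, fbx₂, fby₁, fby₂, fdx₁, fdx₂, fdy₁, fdy₂, hX, hY,
    hXle, hYle, -, -⟩ := hFc
  have hwx : x₁ + 8 ≤ x₂ := by omega
  have hwy : y₁ + 8 ≤ y₂ := by omega
  have key := layout_key hF hW hC hpU
  have memB : ∀ z : ℤ × ℤ, z ∈ B ↔ x₁ ≤ z.1 ∧ z.1 ≤ x₂ ∧ y₁ ≤ z.2 ∧ z.2 ≤ y₂ := fun z => by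
    rw [hBdef, mem_boxR_iff]
  have mk : ∀ {lo hi lo' hi' : ℤ},
      (∀ z : ℤ × ℤ, lo ≤ z.1 → z.1 ≤ hi → lo' ≤ z.2 → z.2 ≤ hi' → x₁ ≤ z.1 → z.1 ≤ x₂ → y₁ ≤ z.2 →
        z.2 ≤ y₂ → z ∈ U) →
      ∀ a b : ℤ, lo ≤ a → a ≤ hi → lo' ≤ b → b ≤ hi' → x₁ ≤ a → a ≤ x₂ → y₁ ≤ b → b ≤ y₂ →
        ((a, b) ∈ U ∧ (a, b) ∈ B) := by
    intro lo hi lo' hi' h a b h1 h2 h3 h4 h5 h6 h7 h8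
    exact ⟨h (a, b) h1 h2 h3 h4 h5 h6 h7 h8, (memB _).2 ⟨h5, h6, h7, h8⟩⟩
  have hLe : ∀ w ∈ U, w ∈ B → X ≤ w.1 := by
    intro w hwU hwB
    obtain ⟨lo, hi, lo', hi', hxT, hyT, -, hwin, hnp⟩ := key w hwU hwB
    rw [memB] at hwB; omega
  by_cases hAb : ∃ w ∈ U, w ∈ B ∧ Y < w.2
  · obtain ⟨w, hwU, hwB, hwc⟩ := hAb
    obtain ⟨lo, hi, lo', hi', hxT, hyT, hcov, hwin, hnp⟩ := key w hwU hwB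
    rw [memB] at hwB
    by_cases hBe : ∃ w ∈ U, w ∈ B ∧ w.2 < Y
    · obtain ⟨v, hvU, hvB, hvc⟩ := hBe
      obtain ⟨lo₂, hi₂, lo₂', hi₂', hxT₂, hyT₂, hcov₂, hvin, hnp₂⟩ := key v hvU hvB
      rw [memB] at hvB
      refine Layout.halfV (-1) x₁ (X - 1) (Or.inr rfl) (fun x => by unfold Side; omega) (by omega)
        ⟨by omega, by omega⟩ (by unfold Side; omega) (fun z hz => ⟨fun hzU => ?_, fun h1 => ?_⟩)
      · have := hLe z hzU hz; unfold SideW; omega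
      · unfold SideW at h1; rw [memB] at hz
        by_cases hzY : Y ≤ z.2
        · exact hcov z (by omega) (by omega) (by omega) (by omega) hz.1 hz.2.1 hz.2.2.1 hz.2.2.2
        · exact hcov₂ z (by omega) (by omega) (by omega) (by omega) hz.1 hz.2.1 hz.2.2.1 hz.2.2.2
    · push Not at hBe
      by_cases hY4 : y₁ + 4 ≤ Y
      · refine Layout.ell 1 1 x₁ (X - 1) y₁ (Y - 1) (Or.inl rfl) (Or.inl rfl)
          (fun x => by unfold Side; omega) (fun y => by unfold Side; omega) (by omega) (by omega)
          ⟨by omega, by omega⟩ ⟨by omega, by omega⟩ (fun z hz => ?_) (Or.inl (by unfold Side; omega))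
        have hz' := (memB z).1 hz
        unfold SideW
        constructor
        · intro hzU; have := hLe z hzU hz; have := hBe z hzU hz; omega
        · intro h
          exact hcov z (by omega) (by omega) (by omega) (by omega) hz'.1 hz'.2.1 hz'.2.2.1 hz'.2.2.2
      · refine Layout.halfV (-1) x₁ (X - 1) (Or.inr rfl) (fun x => by unfold Side; omega) (by omega)
          ⟨by omega, by omega⟩ (by unfold Side; omega) (fun z hz => ⟨fun hzU => ?_, fun h1 => ?_⟩)
        · have := hLe z hzU hz; unfold SideW; omega
        · unfold SideW at h1; rw [memB] at hz
          exact hcov z (by omega) (by omega) (by omega) (by omega) hz.1 hz.2.1 hz.2.2.1 hz.2.2.2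
  · push Not at hAb
    by_cases hne : ∃ w ∈ U, w ∈ B
    · obtain ⟨w, hwU, hwB⟩ := hne
      obtain ⟨lo, hi, lo', hi', hxT, hyT, hcov, hwin, hnp⟩ := key w hwU hwB
      rw [memB] at hwB
      have hc₁ := mk hcov w.1 lo' (by omega) (by omega) le_rfl (by omega) (by omega) (by omega) (by omega)
        (by omega)
      have hc₂ := mk hcov w.1 hi' (by omega) (by omega) (by omega) le_rfl (by omega) (by omega) (by omega)
        (by omega)
      have h₂ := hAb _ hc₂.1 hc₂.2
      simp only at h₂
      refine Layout.ell 1 (-1) x₁ (X - 1) (Y + 1) y₂ (Or.inl rfl) (Or.inr rfl)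
        (fun x => by unfold Side; omega) (fun y => by unfold Side; omega) (by omega) (by omega)
        ⟨by omega, by omega⟩ ⟨by omega, by omega⟩ (fun z hz => ?_) (Or.inl (by unfold Side; omega))
      have hz' := (memB z).1 hz
      unfold SideW
      constructor
      · intro hzU; have := hLe z hzU hz; have := hAb z hzU hz; omega
      · intro h
        exact hcov z (by omega) (by omega) (by omega) (by omega) hz'.1 hz'.2.1 hz'.2.2.1 hz'.2.2.2
    · push Not at hne
      exact Layout.clear fun z hz hzU => hne z hzU hz

/-- Position `NW` of `p` (position NW: `p.1 < X`, `Y < p.2`; a tile missing `p` has `lo = X` or `hi' = Y`). [cite: NewmanTassionWu2017, §3.5 (proof of Lemma 3.16)] -/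
theorem layout_NW (hF : IsFrame n p x₁ x₂ y₁ y₂ X Y) (hW : IsFrameND n x₁ x₂ y₁ X Y)
    (hC : ∀ c ∈ C, LatCentre n c) (hpU : p ∉ tileUnion C) (hpx : p.1 < X) (hpy : Y < p.2) :
    Layout x₁ x₂ y₁ y₂ X Y (tileUnion C) p := by
  set U := tileUnion C with hU
  set B := boxR x₁ x₂ y₁ y₂ with hBdef
  have hFc := hF
  obtain ⟨fx₁, fx₂, fy₁, fy₂, fpx₁, fpx₂, fpy₁, fpy₂, fbx₁, fbx₂, fby₁, fby₂, fdx₁, fdx₂, fdy₁, fdy₂, hX, hY,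
    hXle, hYle, -, -⟩ := hFc
  have hwx : x₁ + 8 ≤ x₂ := by omega
  have hwy : y₁ + 8 ≤ y₂ := by omega
  have key := layout_key hF hW hC hpU
  have memB : ∀ z : ℤ × ℤ, z ∈ B ↔ x₁ ≤ z.1 ∧ z.1 ≤ x₂ ∧ y₁ ≤ z.2 ∧ z.2 ≤ y₂ := fun z => by
    rw [hBdef, mem_boxR_iff]
  have mk : ∀ {lo hi lo' hi' : ℤ},
      (∀ z : ℤ × ℤ, lo ≤ z.1 → z.1 ≤ hi → lo' ≤ z.2 → z.2 ≤ hi' → x₁ ≤ z.1 → z.1 ≤ x₂ → y₁ ≤ z.2 →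
        z.2 ≤ y₂ → z ∈ U) →
      ∀ a b : ℤ, lo ≤ a → a ≤ hi → lo' ≤ b → b ≤ hi' → x₁ ≤ a → a ≤ x₂ → y₁ ≤ b → b ≤ y₂ →
        ((a, b) ∈ U ∧ (a, b) ∈ B) := by
    intro lo hi lo' hi' h a b h1 h2 h3 h4 h5 h6 h7 h8
    exact ⟨h (a, b) h1 h2 h3 h4 h5 h6 h7 h8, (memB _).2 ⟨h5, h6, h7, h8⟩⟩
  by_cases hAb : ∃ w ∈ U, w ∈ B ∧ Y < w.2
  · obtain ⟨w, hwU, hwB, hwc⟩ := hAb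
    obtain ⟨lo, hi, lo', hi', hxT, hyT, hcov, hwin, hnp⟩ := key w hwU hwB
    rw [memB] at hwB
    by_cases hLe : ∃ w ∈ U, w ∈ B ∧ w.1 < X
    · -- quadrant
      obtain ⟨v, hvU, hvB, hvc⟩ := hLe
      obtain ⟨lo₂, hi₂, lo₂', hi₂', hxT₂, hyT₂, hcov₂, hvin, hnp₂⟩ := key v hvU hvB
      rw [memB] at hvB
      refine Layout.quad (-1) 1 x₁ (X - 1) (Y + 1) y₂ (Or.inr rfl) (Or.inl rfl)
        (fun x => by unfold Side; omega) (fun y => by unfold Side; omega) (by omega) (by omega)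
        ⟨by omega, by omega⟩ ⟨by omega, by omega⟩ ⟨by unfold Side; omega, by unfold Side; omega⟩
        (fun z hz h1 h2 hzU => ?_) (fun z hz h1 h2 => ?_) (fun z hz h1 h2 => ?_)
      · obtain ⟨lo₃, hi₃, lo₃', hi₃', hxT₃, hyT₃, -, hzin, hnp₃⟩ := key z hzU hz
        rw [memB] at hz; unfold Side at h1 h2; omega
      · rw [memB] at hz; unfold SideW at h1 h2
        exact hcov z (by omega) (by omega) (by omega) (by omega) hz.1 hz.2.1 hz.2.2.1 hz.2.2.2
      · rw [memB] at hz; unfold SideW at h1 h2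
        exact hcov₂ z (by omega) (by omega) (by omega) (by omega) hz.1 hz.2.1 hz.2.2.1 hz.2.2.2
    · push Not at hLe
      have hlo : lo = X := by
        have := hLe (lo, w.2) (mk hcov lo w.2 le_rfl (by omega) (by omega) (by omega) (by omega)
          (by omega) (by omega) (by omega)).1 (mk hcov lo w.2 le_rfl (by omega) (by omega) (by omega)
          (by omega) (by omega) (by omega) (by omega)).2
        simp only at this; omega
      by_cases hBe : ∃ w ∈ U, w ∈ B ∧ w.2 < Y
      · -- half-box left of `X`, the column `X` covered above `Y` by `w`'s tile, below by `v`'s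
        obtain ⟨v, hvU, hvB, hvc⟩ := hBe
        obtain ⟨lo₂, hi₂, lo₂', hi₂', hxT₂, hyT₂, hcov₂, hvin, hnp₂⟩ := key v hvU hvB
        rw [memB] at hvB
        have hlo₂ : lo₂ = X := by
          have := hLe (lo₂, v.2) (mk hcov₂ lo₂ v.2 le_rfl (by omega) (by omega) (by omega) (by omega)
            (by omega) (by omega) (by omega)).1 (mk hcov₂ lo₂ v.2 le_rfl (by omega) (by omega)
            (by omega) (by omega) (by omega) (by omega) (by omega)).2
          simp only at this; omega
        refine Layout.halfV (-1) x₁ (X - 1) (Or.inr rfl) (fun x => by unfold Side; omega) (by omega)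
          ⟨by omega, by omega⟩ (by unfold Side; omega) (fun z hz => ⟨fun hzU => ?_, fun h1 => ?_⟩)
        · have := hLe z hzU hz; unfold SideW; omega
        · unfold SideW at h1; rw [memB] at hz
          by_cases hzY : Y ≤ z.2
          · exact hcov z (by omega) (by omega) (by omega) (by omega) hz.1 hz.2.1 hz.2.2.1 hz.2.2.2
          · exact hcov₂ z (by omega) (by omega) (by omega) (by omega) hz.1 hz.2.1 hz.2.2.1 hz.2.2.2
      · push Not at hBe
        by_cases hY4 : y₁ + 4 ≤ Y
        · -- `U ∩ B = [X,x₂] × [Y,y₂]`: L-shape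
          refine Layout.ell 1 1 x₁ (X - 1) y₁ (Y - 1) (Or.inl rfl) (Or.inl rfl)
            (fun x => by unfold Side; omega) (fun y => by unfold Side; omega) (by omega) (by omega)
            ⟨by omega, by omega⟩ ⟨by omega, by omega⟩ (fun z hz => ?_) (Or.inl (by unfold Side; omega))
          have hz' := (memB z).1 hz
          unfold SideW
          constructor
          · intro hzU; have := hLe z hzU hz; have := hBe z hzU hz; omega
          · intro h
            exact hcov z (by omega) (by omega) (by omega) (by omega) hz'.1 hz'.2.1 hz'.2.2.1 hz'.2.2.2
        · -- `Y ∈ {y₁ - 1, y₁}`: `U ∩ B = [X,x₂] × [y₁,y₂]`, half-box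
          refine Layout.halfV (-1) x₁ (X - 1) (Or.inr rfl) (fun x => by unfold Side; omega) (by omega)
            ⟨by omega, by omega⟩ (by unfold Side; omega) (fun z hz => ⟨fun hzU => ?_, fun h1 => ?_⟩)
          · have := hLe z hzU hz; unfold SideW; omega
          · unfold SideW at h1; rw [memB] at hz
            exact hcov z (by omega) (by omega) (by omega) (by omega) hz.1 hz.2.1 hz.2.2.1 hz.2.2.2
  · push Not at hAb
    by_cases hLe : ∃ w ∈ U, w ∈ B ∧ w.1 < X
    · obtain ⟨v, hvU, hvB, hvc⟩ := hLe
      obtain ⟨lo₂, hi₂, lo₂', hi₂', hxT₂, hyT₂, hcov₂, hvin, hnp₂⟩ := key v hvU hvB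
      rw [memB] at hvB
      by_cases hRi : ∃ w ∈ U, w ∈ B ∧ X < w.1
      · -- half-box above `Y`, the row `Y` covered left of `X` by `v`'s tile, right by `u`'s
        obtain ⟨u, huU, huB, huc⟩ := hRi
        obtain ⟨lo₃, hi₃, lo₃', hi₃', hxT₃, hyT₃, hcov₃, huin, hnp₃⟩ := key u huU huB
        rw [memB] at huB
        have hhi₃ : hi₃' = Y := by
          have := hAb (u.1, hi₃') (mk hcov₃ u.1 hi₃' (by omega) (by omega) (by omega) le_rfl (by omega)
            (by omega) (by omega) (by omega)).1 (mk hcov₃ u.1 hi₃' (by omega) (by omega) (by omega)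
            le_rfl (by omega) (by omega) (by omega) (by omega)).2
          simp only at this; omega
        refine Layout.halfH 1 (Y + 1) y₂ (Or.inl rfl) (fun y => by unfold Side; omega) (by omega)
          ⟨by omega, by omega⟩ (by unfold Side; omega) (fun z hz => ⟨fun hzU => ?_, fun h1 => ?_⟩)
        · have := hAb z hzU hz; unfold SideW; omega
        · unfold SideW at h1; rw [memB] at hz
          by_cases hzX : z.1 ≤ X
          · exact hcov₂ z (by omega) (by omega) (by omega) (by omega) hz.1 hz.2.1 hz.2.2.1 hz.2.2.2
          · exact hcov₃ z (by omega) (by omega) (by omega) (by omega) hz.1 hz.2.1 hz.2.2.1 hz.2.2.2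
      · push Not at hRi
        by_cases hX4 : X + 4 ≤ x₂
        · -- `U ∩ B = [x₁,X] × [y₁,Y]`: L-shape
          refine Layout.ell (-1) (-1) (X + 1) x₂ (Y + 1) y₂ (Or.inr rfl) (Or.inr rfl)
            (fun x => by unfold Side; omega) (fun y => by unfold Side; omega) (by omega) (by omega)
            ⟨by omega, by omega⟩ ⟨by omega, by omega⟩ (fun z hz => ?_) (Or.inr (by unfold Side; omega))
          have hz' := (memB z).1 hz
          unfold SideW
          constructor
          · intro hzU; have := hRi z hzU hz; have := hAb z hzU hz; omega
          · intro h
            exact hcov₂ z (by omega) (by omega) (by omega) (by omega) hz'.1 hz'.2.1 hz'.2.2.1 hz'.2.2.2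
        · -- `X = x₂`: `U ∩ B = [x₁,x₂] × [y₁,Y]`, half-box
          refine Layout.halfH 1 (Y + 1) y₂ (Or.inl rfl) (fun y => by unfold Side; omega) (by omega)
            ⟨by omega, by omega⟩ (by unfold Side; omega) (fun z hz => ⟨fun hzU => ?_, fun h1 => ?_⟩)
          · have := hAb z hzU hz; unfold SideW; omega
          · unfold SideW at h1; rw [memB] at hz
            exact hcov₂ z (by omega) (by omega) (by omega) (by omega) hz.1 hz.2.1 hz.2.2.1 hz.2.2.2
    · push Not at hLe
      by_cases hne : ∃ w ∈ U, w ∈ B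
      · -- `U ∩ B = [X,x₂] × [y₁,Y]`: L-shape
        obtain ⟨w, hwU, hwB⟩ := hne
        obtain ⟨lo, hi, lo', hi', hxT, hyT, hcov, hwin, hnp⟩ := key w hwU hwB
        rw [memB] at hwB
        have hlo : lo = X := by
          have := hLe (lo, w.2) (mk hcov lo w.2 le_rfl (by omega) (by omega) (by omega) (by omega)
            (by omega) (by omega) (by omega)).1 (mk hcov lo w.2 le_rfl (by omega) (by omega) (by omega)
            (by omega) (by omega) (by omega) (by omega)).2
          simp only at this; omega
        have hhi : hi' = Y := by
          have := hAb (w.1, hi') (mk hcov w.1 hi' (by omega) (by omega) (by omega) le_rfl (by omega)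
            (by omega) (by omega) (by omega)).1 (mk hcov w.1 hi' (by omega) (by omega) (by omega) le_rfl
            (by omega) (by omega) (by omega) (by omega)).2
          simp only at this; omega
        refine Layout.ell 1 (-1) x₁ (X - 1) (Y + 1) y₂ (Or.inl rfl) (Or.inr rfl)
          (fun x => by unfold Side; omega) (fun y => by unfold Side; omega) (by omega) (by omega)
          ⟨by omega, by omega⟩ ⟨by omega, by omega⟩ (fun z hz => ?_) (Or.inl (by unfold Side; omega))
        have hz' := (memB z).1 hz
        unfold SideW
        constructor
        · intro hzU; have := hLe z hzU hz; have := hAb z hzU hz; omega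
        · intro h
          exact hcov z (by omega) (by omega) (by omega) (by omega) hz'.1 hz'.2.1 hz'.2.2.1 hz'.2.2.2
      · push Not at hne
        exact Layout.clear fun z hz hzU => hne z hzU hz

/-- Position `S` of `p` (position S: `p.1 = X`, `p.2 < Y`; a tile missing `p` has `lo' = Y`). [cite: NewmanTassionWu2017, §3.5 (proof of Lemma 3.16)] -/
theorem layout_S (hF : IsFrame n p x₁ x₂ y₁ y₂ X Y) (hW : IsFrameND n x₁ x₂ y₁ X Y)
    (hC : ∀ c ∈ C, LatCentre n c) (hpU : p ∉ tileUnion C) (hpx : p.1 = X) (hpy : p.2 < Y) :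
    Layout x₁ x₂ y₁ y₂ X Y (tileUnion C) p := by
  set U := tileUnion C with hU
  set B := boxR x₁ x₂ y₁ y₂ with hBdef
  have hFc := hF
  obtain ⟨fx₁, fx₂, fy₁, fy₂, fpx₁, fpx₂, fpy₁, fpy₂, fbx₁, fbx₂, fby₁, fby₂, fdx₁, fdx₂, fdy₁, fdy₂, hX, hY,
    hXle, hYle, -, -⟩ := hFc
  have hwx : x₁ + 8 ≤ x₂ := by omega
  have hwy : y₁ + 8 ≤ y₂ := by omega
  have key := layout_key hF hW hC hpU
  have memB : ∀ z : ℤ × ℤ, z ∈ B ↔ x₁ ≤ z.1 ∧ z.1 ≤ x₂ ∧ y₁ ≤ z.2 ∧ z.2 ≤ y₂ := fun z => by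
    rw [hBdef, mem_boxR_iff]
  have mk : ∀ {lo hi lo' hi' : ℤ},
      (∀ z : ℤ × ℤ, lo ≤ z.1 → z.1 ≤ hi → lo' ≤ z.2 → z.2 ≤ hi' → x₁ ≤ z.1 → z.1 ≤ x₂ → y₁ ≤ z.2 →
        z.2 ≤ y₂ → z ∈ U) →
      ∀ a b : ℤ, lo ≤ a → a ≤ hi → lo' ≤ b → b ≤ hi' → x₁ ≤ a → a ≤ x₂ → y₁ ≤ b → b ≤ y₂ →
        ((a, b) ∈ U ∧ (a, b) ∈ B) := by
    intro lo hi lo' hi' h a b h1 h2 h3 h4 h5 h6 h7 h8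
    exact ⟨h (a, b) h1 h2 h3 h4 h5 h6 h7 h8, (memB _).2 ⟨h5, h6, h7, h8⟩⟩
  have hBe : ∀ w ∈ U, w ∈ B → Y ≤ w.2 := by
    intro w hwU hwB
    obtain ⟨lo, hi, lo', hi', hxT, hyT, -, hwin, hnp⟩ := key w hwU hwB
    rw [memB] at hwB; omega
  by_cases hLe : ∃ w ∈ U, w ∈ B ∧ w.1 < X
  · obtain ⟨v, hvU, hvB, hvc⟩ := hLe
    obtain ⟨lo₂, hi₂, lo₂', hi₂', hxT₂, hyT₂, hcov₂, hvin, hnp₂⟩ := key v hvU hvB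
    rw [memB] at hvB
    by_cases hRi : ∃ w ∈ U, w ∈ B ∧ X < w.1
    · obtain ⟨u, huU, huB, huc⟩ := hRi
      obtain ⟨lo₃, hi₃, lo₃', hi₃', hxT₃, hyT₃, hcov₃, huin, hnp₃⟩ := key u huU huB
      rw [memB] at huB
      refine Layout.halfH (-1) y₁ (Y - 1) (Or.inr rfl) (fun y => by unfold Side; omega) (by omega)
        ⟨by omega, by omega⟩ (by unfold Side; omega) (fun z hz => ⟨fun hzU => ?_, fun h1 => ?_⟩)
      · have := hBe z hzU hz; unfold SideW; omega
      · unfold SideW at h1; rw [memB] at hz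
        by_cases hzX : z.1 ≤ X
        · exact hcov₂ z (by omega) (by omega) (by omega) (by omega) hz.1 hz.2.1 hz.2.2.1 hz.2.2.2
        · exact hcov₃ z (by omega) (by omega) (by omega) (by omega) hz.1 hz.2.1 hz.2.2.1 hz.2.2.2
    · push Not at hRi
      by_cases hX4 : X + 4 ≤ x₂
      · refine Layout.ell (-1) 1 (X + 1) x₂ y₁ (Y - 1) (Or.inr rfl) (Or.inl rfl)
          (fun x => by unfold Side; omega) (fun y => by unfold Side; omega) (by omega) (by omega)
          ⟨by omega, by omega⟩ ⟨by omega, by omega⟩ (fun z hz => ?_) (Or.inr (by unfold Side; omega))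
        have hz' := (memB z).1 hz
        unfold SideW
        constructor
        · intro hzU; have := hRi z hzU hz; have := hBe z hzU hz; omega
        · intro h
          exact hcov₂ z (by omega) (by omega) (by omega) (by omega) hz'.1 hz'.2.1 hz'.2.2.1 hz'.2.2.2
      · refine Layout.halfH (-1) y₁ (Y - 1) (Or.inr rfl) (fun y => by unfold Side; omega) (by omega)
          ⟨by omega, by omega⟩ (by unfold Side; omega) (fun z hz => ⟨fun hzU => ?_, fun h1 => ?_⟩)
        · have := hBe z hzU hz; unfold SideW; omega
        · unfold SideW at h1; rw [memB] at hz
          exact hcov₂ z (by omega) (by omega) (by omega) (by omega) hz.1 hz.2.1 hz.2.2.1 hz.2.2.2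
  · push Not at hLe
    by_cases hRi : ∃ w ∈ U, w ∈ B ∧ X < w.1
    · obtain ⟨u, huU, huB, huc⟩ := hRi
      obtain ⟨lo₃, hi₃, lo₃', hi₃', hxT₃, hyT₃, hcov₃, huin, hnp₃⟩ := key u huU huB
      rw [memB] at huB
      have hc₃ := mk hcov₃ lo₃ u.2 le_rfl (by omega) (by omega) (by omega) (by omega) (by omega) (by omega)
        (by omega)
      have hlo₃ := hLe _ hc₃.1 hc₃.2
      simp only at hlo₃
      by_cases hX4 : x₁ + 4 ≤ X
      · refine Layout.ell 1 1 x₁ (X - 1) y₁ (Y - 1) (Or.inl rfl) (Or.inl rfl)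
          (fun x => by unfold Side; omega) (fun y => by unfold Side; omega) (by omega) (by omega)
          ⟨by omega, by omega⟩ ⟨by omega, by omega⟩ (fun z hz => ?_) (Or.inr (by unfold Side; omega))
        have hz' := (memB z).1 hz
        unfold SideW
        constructor
        · intro hzU; have := hLe z hzU hz; have := hBe z hzU hz; omega
        · intro h
          exact hcov₃ z (by omega) (by omega) (by omega) (by omega) hz'.1 hz'.2.1 hz'.2.2.1 hz'.2.2.2
      · refine Layout.halfH (-1) y₁ (Y - 1) (Or.inr rfl) (fun y => by unfold Side; omega) (by omega)
          ⟨by omega, by omega⟩ (by unfold Side; omega) (fun z hz => ⟨fun hzU => ?_, fun h1 => ?_⟩)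
        · have := hBe z hzU hz; unfold SideW; omega
        · unfold SideW at h1; rw [memB] at hz
          exact hcov₃ z (by omega) (by omega) (by omega) (by omega) hz.1 hz.2.1 hz.2.2.1 hz.2.2.2
    · push Not at hRi
      by_cases hne : ∃ w ∈ U, w ∈ B
      · obtain ⟨w, hwU, hwB⟩ := hne
        obtain ⟨lo, hi, lo', hi', hxT, hyT, hcov, hwin, hnp⟩ := key w hwU hwB
        rw [memB] at hwB
        have hc₁ := mk hcov lo w.2 le_rfl (by omega) (by omega) (by omega) (by omega) (by omega) (by omega)
          (by omega)
        have h₁ := hLe _ hc₁.1 hc₁.2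
        have hc₂ := mk hcov hi w.2 (by omega) le_rfl (by omega) (by omega) (by omega) (by omega) (by omega)
          (by omega)
        have h₂ := hRi _ hc₂.1 hc₂.2
        simp only at h₁ h₂
        by_cases hXw : X = x₁
        · refine Layout.ell (-1) 1 (X + 1) x₂ y₁ (Y - 1) (Or.inr rfl) (Or.inl rfl)
            (fun x => by unfold Side; omega) (fun y => by unfold Side; omega) (by omega) (by omega)
            ⟨by omega, by omega⟩ ⟨by omega, by omega⟩ (fun z hz => ?_) (Or.inr (by unfold Side; omega))
          have hz' := (memB z).1 hz
          unfold SideW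
          constructor
          · intro hzU; have := hRi z hzU hz; have := hBe z hzU hz; omega
          · intro h
            exact hcov z (by omega) (by omega) (by omega) (by omega) hz'.1 hz'.2.1 hz'.2.2.1 hz'.2.2.2
        · refine Layout.ell 1 1 x₁ (X - 1) y₁ (Y - 1) (Or.inl rfl) (Or.inl rfl)
            (fun x => by unfold Side; omega) (fun y => by unfold Side; omega) (by omega) (by omega)
            ⟨by omega, by omega⟩ ⟨by omega, by omega⟩ (fun z hz => ?_) (Or.inr (by unfold Side; omega))
          have hz' := (memB z).1 hz
          unfold SideW
          constructor
          · intro hzU; have := hLe z hzU hz; have := hBe z hzU hz; omega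
          · intro h
            exact hcov z (by omega) (by omega) (by omega) (by omega) hz'.1 hz'.2.1 hz'.2.2.1 hz'.2.2.2
      · push Not at hne
        exact Layout.clear fun z hz hzU => hne z hzU hz

/-- Position `C` of `p` (centre: every tile meeting the box contains `p`). [cite: NewmanTassionWu2017, §3.5 (proof of Lemma 3.16)] -/
theorem layout_C (hF : IsFrame n p x₁ x₂ y₁ y₂ X Y) (hW : IsFrameND n x₁ x₂ y₁ X Y)
    (hC : ∀ c ∈ C, LatCentre n c) (hpU : p ∉ tileUnion C) (hpx : p.1 = X) (hpy : p.2 = Y) :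
    Layout x₁ x₂ y₁ y₂ X Y (tileUnion C) p := by
  set U := tileUnion C with hU
  set B := boxR x₁ x₂ y₁ y₂ with hBdef
  have hFc := hF
  obtain ⟨fx₁, fx₂, fy₁, fy₂, fpx₁, fpx₂, fpy₁, fpy₂, fbx₁, fbx₂, fby₁, fby₂, fdx₁, fdx₂, fdy₁, fdy₂, hX, hY,
    hXle, hYle, -, -⟩ := hFc
  have hwx : x₁ + 8 ≤ x₂ := by omega
  have hwy : y₁ + 8 ≤ y₂ := by omega
  have key := layout_key hF hW hC hpU
  have memB : ∀ z : ℤ × ℤ, z ∈ B ↔ x₁ ≤ z.1 ∧ z.1 ≤ x₂ ∧ y₁ ≤ z.2 ∧ z.2 ≤ y₂ := fun z => by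
    rw [hBdef, mem_boxR_iff]
  have mk : ∀ {lo hi lo' hi' : ℤ},
      (∀ z : ℤ × ℤ, lo ≤ z.1 → z.1 ≤ hi → lo' ≤ z.2 → z.2 ≤ hi' → x₁ ≤ z.1 → z.1 ≤ x₂ → y₁ ≤ z.2 →
        z.2 ≤ y₂ → z ∈ U) →
      ∀ a b : ℤ, lo ≤ a → a ≤ hi → lo' ≤ b → b ≤ hi' → x₁ ≤ a → a ≤ x₂ → y₁ ≤ b → b ≤ y₂ →
        ((a, b) ∈ U ∧ (a, b) ∈ B) := by
    intro lo hi lo' hi' h a b h1 h2 h3 h4 h5 h6 h7 h8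
    exact ⟨h (a, b) h1 h2 h3 h4 h5 h6 h7 h8, (memB _).2 ⟨h5, h6, h7, h8⟩⟩
  refine Layout.clear fun z hz hzU => ?_
  obtain ⟨lo, hi, lo', hi', hxT, hyT, -, hzin, hnp⟩ := key z hzU hz
  rw [memB] at hz
  omega

/-- Position `N` of `p` (position N: `p.1 = X`, `Y < p.2`; a tile missing `p` has `hi' = Y`). [cite: NewmanTassionWu2017, §3.5 (proof of Lemma 3.16)] -/
theorem layout_N (hF : IsFrame n p x₁ x₂ y₁ y₂ X Y) (hW : IsFrameND n x₁ x₂ y₁ X Y)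
    (hC : ∀ c ∈ C, LatCentre n c) (hpU : p ∉ tileUnion C) (hpx : p.1 = X) (hpy : Y < p.2) :
    Layout x₁ x₂ y₁ y₂ X Y (tileUnion C) p := by
  set U := tileUnion C with hU
  set B := boxR x₁ x₂ y₁ y₂ with hBdef
  have hFc := hF
  obtain ⟨fx₁, fx₂, fy₁, fy₂, fpx₁, fpx₂, fpy₁, fpy₂, fbx₁, fbx₂, fby₁, fby₂, fdx₁, fdx₂, fdy₁, fdy₂, hX, hY,
    hXle, hYle, -, -⟩ := hFc
  have hwx : x₁ + 8 ≤ x₂ := by omega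
  have hwy : y₁ + 8 ≤ y₂ := by omega
  have key := layout_key hF hW hC hpU
  have memB : ∀ z : ℤ × ℤ, z ∈ B ↔ x₁ ≤ z.1 ∧ z.1 ≤ x₂ ∧ y₁ ≤ z.2 ∧ z.2 ≤ y₂ := fun z => by
    rw [hBdef, mem_boxR_iff]
  have mk : ∀ {lo hi lo' hi' : ℤ},
      (∀ z : ℤ × ℤ, lo ≤ z.1 → z.1 ≤ hi → lo' ≤ z.2 → z.2 ≤ hi' → x₁ ≤ z.1 → z.1 ≤ x₂ → y₁ ≤ z.2 →
        z.2 ≤ y₂ → z ∈ U) →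
      ∀ a b : ℤ, lo ≤ a → a ≤ hi → lo' ≤ b → b ≤ hi' → x₁ ≤ a → a ≤ x₂ → y₁ ≤ b → b ≤ y₂ →
        ((a, b) ∈ U ∧ (a, b) ∈ B) := by
    intro lo hi lo' hi' h a b h1 h2 h3 h4 h5 h6 h7 h8
    exact ⟨h (a, b) h1 h2 h3 h4 h5 h6 h7 h8, (memB _).2 ⟨h5, h6, h7, h8⟩⟩
  have hAb : ∀ w ∈ U, w ∈ B → w.2 ≤ Y := by
    intro w hwU hwB
    obtain ⟨lo, hi, lo', hi', hxT, hyT, -, hwin, hnp⟩ := key w hwU hwB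
    rw [memB] at hwB; omega
  by_cases hLe : ∃ w ∈ U, w ∈ B ∧ w.1 < X
  · obtain ⟨v, hvU, hvB, hvc⟩ := hLe
    obtain ⟨lo₂, hi₂, lo₂', hi₂', hxT₂, hyT₂, hcov₂, hvin, hnp₂⟩ := key v hvU hvB
    rw [memB] at hvB
    by_cases hRi : ∃ w ∈ U, w ∈ B ∧ X < w.1
    · obtain ⟨u, huU, huB, huc⟩ := hRi
      obtain ⟨lo₃, hi₃, lo₃', hi₃', hxT₃, hyT₃, hcov₃, huin, hnp₃⟩ := key u huU huB
      rw [memB] at huB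
      refine Layout.halfH 1 (Y + 1) y₂ (Or.inl rfl) (fun y => by unfold Side; omega) (by omega)
        ⟨by omega, by omega⟩ (by unfold Side; omega) (fun z hz => ⟨fun hzU => ?_, fun h1 => ?_⟩)
      · have := hAb z hzU hz; unfold SideW; omega
      · unfold SideW at h1; rw [memB] at hz
        by_cases hzX : z.1 ≤ X
        · exact hcov₂ z (by omega) (by omega) (by omega) (by omega) hz.1 hz.2.1 hz.2.2.1 hz.2.2.2
        · exact hcov₃ z (by omega) (by omega) (by omega) (by omega) hz.1 hz.2.1 hz.2.2.1 hz.2.2.2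
    · push Not at hRi
      by_cases hX4 : X + 4 ≤ x₂
      · refine Layout.ell (-1) (-1) (X + 1) x₂ (Y + 1) y₂ (Or.inr rfl) (Or.inr rfl)
          (fun x => by unfold Side; omega) (fun y => by unfold Side; omega) (by omega) (by omega)
          ⟨by omega, by omega⟩ ⟨by omega, by omega⟩ (fun z hz => ?_) (Or.inr (by unfold Side; omega))
        have hz' := (memB z).1 hz
        unfold SideW
        constructor
        · intro hzU; have := hRi z hzU hz; have := hAb z hzU hz; omega
        · intro h
          exact hcov₂ z (by omega) (by omega) (by omega) (by omega) hz'.1 hz'.2.1 hz'.2.2.1 hz'.2.2.2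
      · refine Layout.halfH 1 (Y + 1) y₂ (Or.inl rfl) (fun y => by unfold Side; omega) (by omega)
          ⟨by omega, by omega⟩ (by unfold Side; omega) (fun z hz => ⟨fun hzU => ?_, fun h1 => ?_⟩)
        · have := hAb z hzU hz; unfold SideW; omega
        · unfold SideW at h1; rw [memB] at hz
          exact hcov₂ z (by omega) (by omega) (by omega) (by omega) hz.1 hz.2.1 hz.2.2.1 hz.2.2.2
  · push Not at hLe
    by_cases hRi : ∃ w ∈ U, w ∈ B ∧ X < w.1
    · obtain ⟨u, huU, huB, huc⟩ := hRi
      obtain ⟨lo₃, hi₃, lo₃', hi₃', hxT₃, hyT₃, hcov₃, huin, hnp₃⟩ := key u huU huB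
      rw [memB] at huB
      by_cases hX4 : x₁ + 4 ≤ X
      · refine Layout.ell 1 (-1) x₁ (X - 1) (Y + 1) y₂ (Or.inl rfl) (Or.inr rfl)
          (fun x => by unfold Side; omega) (fun y => by unfold Side; omega) (by omega) (by omega)
          ⟨by omega, by omega⟩ ⟨by omega, by omega⟩ (fun z hz => ?_) (Or.inr (by unfold Side; omega))
        have hz' := (memB z).1 hz
        unfold SideW
        constructor
        · intro hzU; have := hLe z hzU hz; have := hAb z hzU hz; omega
        · intro h
          exact hcov₃ z (by omega) (by omega) (by omega) (by omega) hz'.1 hz'.2.1 hz'.2.2.1 hz'.2.2.2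
      · refine Layout.halfH 1 (Y + 1) y₂ (Or.inl rfl) (fun y => by unfold Side; omega) (by omega)
          ⟨by omega, by omega⟩ (by unfold Side; omega) (fun z hz => ⟨fun hzU => ?_, fun h1 => ?_⟩)
        · have := hAb z hzU hz; unfold SideW; omega
        · unfold SideW at h1; rw [memB] at hz
          exact hcov₃ z (by omega) (by omega) (by omega) (by omega) hz.1 hz.2.1 hz.2.2.1 hz.2.2.2
    · push Not at hRi
      by_cases hne : ∃ w ∈ U, w ∈ B
      · -- the tiles meet `B` in the column `X` only (`X` is a wall side): L-shape at the wall
        obtain ⟨w, hwU, hwB⟩ := hne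
        obtain ⟨lo, hi, lo', hi', hxT, hyT, hcov, hwin, hnp⟩ := key w hwU hwB
        rw [memB] at hwB
        have h1 := hLe (lo, w.2) (mk hcov lo w.2 le_rfl (by omega) (by omega) (by omega) (by omega)
          (by omega) (by omega) (by omega)).1 (mk hcov lo w.2 le_rfl (by omega) (by omega) (by omega)
          (by omega) (by omega) (by omega) (by omega)).2
        have h2 := hRi (hi, w.2) (mk hcov hi w.2 (by omega) le_rfl (by omega) (by omega) (by omega)
          (by omega) (by omega) (by omega)).1 (mk hcov hi w.2 (by omega) le_rfl (by omega) (by omega)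
          (by omega) (by omega) (by omega) (by omega)).2
        simp only at h1 h2
        by_cases hXw : X = x₁
        · refine Layout.ell (-1) (-1) (X + 1) x₂ (Y + 1) y₂ (Or.inr rfl) (Or.inr rfl)
            (fun x => by unfold Side; omega) (fun y => by unfold Side; omega) (by omega) (by omega)
            ⟨by omega, by omega⟩ ⟨by omega, by omega⟩ (fun z hz => ?_) (Or.inr (by unfold Side; omega))
          have hz' := (memB z).1 hz
          unfold SideW
          constructor
          · intro hzU; have := hRi z hzU hz; have := hAb z hzU hz; omega
          · intro h
            exact hcov z (by omega) (by omega) (by omega) (by omega) hz'.1 hz'.2.1 hz'.2.2.1 hz'.2.2.2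
        · refine Layout.ell 1 (-1) x₁ (X - 1) (Y + 1) y₂ (Or.inl rfl) (Or.inr rfl)
            (fun x => by unfold Side; omega) (fun y => by unfold Side; omega) (by omega) (by omega)
            ⟨by omega, by omega⟩ ⟨by omega, by omega⟩ (fun z hz => ?_) (Or.inr (by unfold Side; omega))
          have hz' := (memB z).1 hz
          unfold SideW
          constructor
          · intro hzU; have := hLe z hzU hz; have := hAb z hzU hz; omega
          · intro h
            exact hcov z (by omega) (by omega) (by omega) (by omega) hz'.1 hz'.2.1 hz'.2.2.1 hz'.2.2.2
      · push Not at hne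
        exact Layout.clear fun z hz hzU => hne z hzU hz

/-- Position `SE` of `p` (position SE: `X < p.1`, `p.2 < Y`; a tile missing `p` has `hi = X` or `lo' = Y`). [cite: NewmanTassionWu2017, §3.5 (proof of Lemma 3.16)] -/
theorem layout_SE (hF : IsFrame n p x₁ x₂ y₁ y₂ X Y) (hW : IsFrameND n x₁ x₂ y₁ X Y)
    (hC : ∀ c ∈ C, LatCentre n c) (hpU : p ∉ tileUnion C) (hpx : X < p.1) (hpy : p.2 < Y) :
    Layout x₁ x₂ y₁ y₂ X Y (tileUnion C) p := by
  set U := tileUnion C with hU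
  set B := boxR x₁ x₂ y₁ y₂ with hBdef
  have hFc := hF
  obtain ⟨fx₁, fx₂, fy₁, fy₂, fpx₁, fpx₂, fpy₁, fpy₂, fbx₁, fbx₂, fby₁, fby₂, fdx₁, fdx₂, fdy₁, fdy₂, hX, hY,
    hXle, hYle, -, -⟩ := hFc
  have hwx : x₁ + 8 ≤ x₂ := by omega
  have hwy : y₁ + 8 ≤ y₂ := by omega
  have key := layout_key hF hW hC hpU
  have memB : ∀ z : ℤ × ℤ, z ∈ B ↔ x₁ ≤ z.1 ∧ z.1 ≤ x₂ ∧ y₁ ≤ z.2 ∧ z.2 ≤ y₂ := fun z => by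
    rw [hBdef, mem_boxR_iff]
  have mk : ∀ {lo hi lo' hi' : ℤ},
      (∀ z : ℤ × ℤ, lo ≤ z.1 → z.1 ≤ hi → lo' ≤ z.2 → z.2 ≤ hi' → x₁ ≤ z.1 → z.1 ≤ x₂ → y₁ ≤ z.2 →
        z.2 ≤ y₂ → z ∈ U) →
      ∀ a b : ℤ, lo ≤ a → a ≤ hi → lo' ≤ b → b ≤ hi' → x₁ ≤ a → a ≤ x₂ → y₁ ≤ b → b ≤ y₂ →
        ((a, b) ∈ U ∧ (a, b) ∈ B) := by
    intro lo hi lo' hi' h a b h1 h2 h3 h4 h5 h6 h7 h8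
    exact ⟨h (a, b) h1 h2 h3 h4 h5 h6 h7 h8, (memB _).2 ⟨h5, h6, h7, h8⟩⟩
  by_cases hBe : ∃ w ∈ U, w ∈ B ∧ w.2 < Y
  · obtain ⟨w, hwU, hwB, hwc⟩ := hBe
    obtain ⟨lo, hi, lo', hi', hxT, hyT, hcov, hwin, hnp⟩ := key w hwU hwB
    rw [memB] at hwB
    by_cases hRi : ∃ w ∈ U, w ∈ B ∧ X < w.1
    · obtain ⟨v, hvU, hvB, hvc⟩ := hRi
      obtain ⟨lo₂, hi₂, lo₂', hi₂', hxT₂, hyT₂, hcov₂, hvin, hnp₂⟩ := key v hvU hvB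
      rw [memB] at hvB
      refine Layout.quad 1 (-1) (X + 1) x₂ y₁ (Y - 1) (Or.inl rfl) (Or.inr rfl)
        (fun x => by unfold Side; omega) (fun y => by unfold Side; omega) (by omega) (by omega)
        ⟨by omega, by omega⟩ ⟨by omega, by omega⟩ ⟨by unfold Side; omega, by unfold Side; omega⟩
        (fun z hz h1 h2 hzU => ?_) (fun z hz h1 h2 => ?_) (fun z hz h1 h2 => ?_)
      · obtain ⟨lo₃, hi₃, lo₃', hi₃', hxT₃, hyT₃, -, hzin, hnp₃⟩ := key z hzU hz
        rw [memB] at hz; unfold Side at h1 h2; omega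
      · rw [memB] at hz; unfold SideW at h1 h2
        exact hcov z (by omega) (by omega) (by omega) (by omega) hz.1 hz.2.1 hz.2.2.1 hz.2.2.2
      · rw [memB] at hz; unfold SideW at h1 h2
        exact hcov₂ z (by omega) (by omega) (by omega) (by omega) hz.1 hz.2.1 hz.2.2.1 hz.2.2.2
    · push Not at hRi
      by_cases hAb : ∃ w ∈ U, w ∈ B ∧ Y < w.2
      · obtain ⟨v, hvU, hvB, hvc⟩ := hAb
        obtain ⟨lo₂, hi₂, lo₂', hi₂', hxT₂, hyT₂, hcov₂, hvin, hnp₂⟩ := key v hvU hvB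
        rw [memB] at hvB
        have hc₂ := mk hcov₂ hi₂ v.2 (by omega) le_rfl (by omega) (by omega) (by omega) (by omega) (by omega)
          (by omega)
        have hhi₂ := hRi _ hc₂.1 hc₂.2
        simp only at hhi₂
        refine Layout.halfV 1 (X + 1) x₂ (Or.inl rfl) (fun x => by unfold Side; omega) (by omega)
          ⟨by omega, by omega⟩ (by unfold Side; omega) (fun z hz => ⟨fun hzU => ?_, fun h1 => ?_⟩)
        · have := hRi z hzU hz; unfold SideW; omega
        · unfold SideW at h1; rw [memB] at hz
          by_cases hzY : z.2 ≤ Y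
          · exact hcov z (by omega) (by omega) (by omega) (by omega) hz.1 hz.2.1 hz.2.2.1 hz.2.2.2
          · exact hcov₂ z (by omega) (by omega) (by omega) (by omega) hz.1 hz.2.1 hz.2.2.1 hz.2.2.2
      · push Not at hAb
        have hc' := mk hcov w.1 hi' (by omega) (by omega) (by omega) le_rfl (by omega) (by omega) (by omega)
          (by omega)
        have hhi := hAb _ hc'.1 hc'.2
        simp only at hhi
        refine Layout.ell (-1) (-1) (X + 1) x₂ (Y + 1) y₂ (Or.inr rfl) (Or.inr rfl)
          (fun x => by unfold Side; omega) (fun y => by unfold Side; omega) (by omega) (by omega)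
          ⟨by omega, by omega⟩ ⟨by omega, by omega⟩ (fun z hz => ?_) (Or.inl (by unfold Side; omega))
        have hz' := (memB z).1 hz
        unfold SideW
        constructor
        · intro hzU; have := hRi z hzU hz; have := hAb z hzU hz; omega
        · intro h
          exact hcov z (by omega) (by omega) (by omega) (by omega) hz'.1 hz'.2.1 hz'.2.2.1 hz'.2.2.2
  · push Not at hBe
    by_cases hRi : ∃ w ∈ U, w ∈ B ∧ X < w.1
    · obtain ⟨v, hvU, hvB, hvc⟩ := hRi
      obtain ⟨lo₂, hi₂, lo₂', hi₂', hxT₂, hyT₂, hcov₂, hvin, hnp₂⟩ := key v hvU hvB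
      rw [memB] at hvB
      by_cases hLe : ∃ w ∈ U, w ∈ B ∧ w.1 < X
      · obtain ⟨u, huU, huB, huc⟩ := hLe
        obtain ⟨lo₃, hi₃, lo₃', hi₃', hxT₃, hyT₃, hcov₃, huin, hnp₃⟩ := key u huU huB
        rw [memB] at huB
        have hc₃ := mk hcov₃ u.1 lo₃' (by omega) (by omega) le_rfl (by omega) (by omega) (by omega) (by omega)
          (by omega)
        have hlo₃ := hBe _ hc₃.1 hc₃.2
        simp only at hlo₃
        refine Layout.halfH (-1) y₁ (Y - 1) (Or.inr rfl) (fun y => by unfold Side; omega) (by omega)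
          ⟨by omega, by omega⟩ (by unfold Side; omega) (fun z hz => ⟨fun hzU => ?_, fun h1 => ?_⟩)
        · have := hBe z hzU hz; unfold SideW; omega
        · unfold SideW at h1; rw [memB] at hz
          by_cases hzX : X ≤ z.1
          · exact hcov₂ z (by omega) (by omega) (by omega) (by omega) hz.1 hz.2.1 hz.2.2.1 hz.2.2.2
          · exact hcov₃ z (by omega) (by omega) (by omega) (by omega) hz.1 hz.2.1 hz.2.2.1 hz.2.2.2
      · push Not at hLe
        have hc₂ := mk hcov₂ lo₂ v.2 le_rfl (by omega) (by omega) (by omega) (by omega) (by omega) (by omega)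
          (by omega)
        have hlo₂ := hLe _ hc₂.1 hc₂.2
        simp only at hlo₂
        by_cases hX4 : x₁ + 4 ≤ X
        · refine Layout.ell 1 1 x₁ (X - 1) y₁ (Y - 1) (Or.inl rfl) (Or.inl rfl)
            (fun x => by unfold Side; omega) (fun y => by unfold Side; omega) (by omega) (by omega)
            ⟨by omega, by omega⟩ ⟨by omega, by omega⟩ (fun z hz => ?_) (Or.inr (by unfold Side; omega))
          have hz' := (memB z).1 hz
          unfold SideW
          constructor
          · intro hzU; have := hLe z hzU hz; have := hBe z hzU hz; omega
          · intro h
            exact hcov₂ z (by omega) (by omega) (by omega) (by omega) hz'.1 hz'.2.1 hz'.2.2.1 hz'.2.2.2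
        · refine Layout.halfH (-1) y₁ (Y - 1) (Or.inr rfl) (fun y => by unfold Side; omega) (by omega)
            ⟨by omega, by omega⟩ (by unfold Side; omega) (fun z hz => ⟨fun hzU => ?_, fun h1 => ?_⟩)
          · have := hBe z hzU hz; unfold SideW; omega
          · unfold SideW at h1; rw [memB] at hz
            exact hcov₂ z (by omega) (by omega) (by omega) (by omega) hz.1 hz.2.1 hz.2.2.1 hz.2.2.2
    · push Not at hRi
      by_cases hne : ∃ w ∈ U, w ∈ B
      · obtain ⟨w, hwU, hwB⟩ := hne
        obtain ⟨lo, hi, lo', hi', hxT, hyT, hcov, hwin, hnp⟩ := key w hwU hwB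
        rw [memB] at hwB
        have hc := mk hcov hi w.2 (by omega) le_rfl (by omega) (by omega) (by omega) (by omega) (by omega)
          (by omega)
        have hhi := hRi _ hc.1 hc.2
        have hc' := mk hcov w.1 lo' (by omega) (by omega) le_rfl (by omega) (by omega) (by omega) (by omega)
          (by omega)
        have hlo' := hBe _ hc'.1 hc'.2
        simp only at hhi hlo'
        refine Layout.ell (-1) 1 (X + 1) x₂ y₁ (Y - 1) (Or.inr rfl) (Or.inl rfl)
          (fun x => by unfold Side; omega) (fun y => by unfold Side; omega) (by omega) (by omega)
          ⟨by omega, by omega⟩ ⟨by omega, by omega⟩ (fun z hz => ?_) (Or.inl (by unfold Side; omega))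
        have hz' := (memB z).1 hz
        unfold SideW
        constructor
        · intro hzU; have := hRi z hzU hz; have := hBe z hzU hz; omega
        · intro h
          exact hcov z (by omega) (by omega) (by omega) (by omega) hz'.1 hz'.2.1 hz'.2.2.1 hz'.2.2.2
      · push Not at hne
        exact Layout.clear fun z hz hzU => hne z hzU hz

/-- Position `E` of `p` (position E: `X < p.1`, `p.2 = Y`; a tile missing `p` has `hi = X`). [cite: NewmanTassionWu2017, §3.5 (proof of Lemma 3.16)] -/
theorem layout_E (hF : IsFrame n p x₁ x₂ y₁ y₂ X Y) (hW : IsFrameND n x₁ x₂ y₁ X Y)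
    (hC : ∀ c ∈ C, LatCentre n c) (hpU : p ∉ tileUnion C) (hpx : X < p.1) (hpy : p.2 = Y) :
    Layout x₁ x₂ y₁ y₂ X Y (tileUnion C) p := by
  set U := tileUnion C with hU
  set B := boxR x₁ x₂ y₁ y₂ with hBdef
  have hFc := hF
  obtain ⟨fx₁, fx₂, fy₁, fy₂, fpx₁, fpx₂, fpy₁, fpy₂, fbx₁, fbx₂, fby₁, fby₂, fdx₁, fdx₂, fdy₁, fdy₂, hX, hY,
    hXle, hYle, -, -⟩ := hFc
  have hwx : x₁ + 8 ≤ x₂ := by omega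
  have hwy : y₁ + 8 ≤ y₂ := by omega
  have key := layout_key hF hW hC hpU
  have memB : ∀ z : ℤ × ℤ, z ∈ B ↔ x₁ ≤ z.1 ∧ z.1 ≤ x₂ ∧ y₁ ≤ z.2 ∧ z.2 ≤ y₂ := fun z => by
    rw [hBdef, mem_boxR_iff]
  have mk : ∀ {lo hi lo' hi' : ℤ},
      (∀ z : ℤ × ℤ, lo ≤ z.1 → z.1 ≤ hi → lo' ≤ z.2 → z.2 ≤ hi' → x₁ ≤ z.1 → z.1 ≤ x₂ → y₁ ≤ z.2 →
        z.2 ≤ y₂ → z ∈ U) →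
      ∀ a b : ℤ, lo ≤ a → a ≤ hi → lo' ≤ b → b ≤ hi' → x₁ ≤ a → a ≤ x₂ → y₁ ≤ b → b ≤ y₂ →
        ((a, b) ∈ U ∧ (a, b) ∈ B) := by
    intro lo hi lo' hi' h a b h1 h2 h3 h4 h5 h6 h7 h8
    exact ⟨h (a, b) h1 h2 h3 h4 h5 h6 h7 h8, (memB _).2 ⟨h5, h6, h7, h8⟩⟩
  have hRi : ∀ w ∈ U, w ∈ B → w.1 ≤ X := by
    intro w hwU hwB
    obtain ⟨lo, hi, lo', hi', hxT, hyT, -, hwin, hnp⟩ := key w hwU hwB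
    rw [memB] at hwB; omega
  by_cases hAb : ∃ w ∈ U, w ∈ B ∧ Y < w.2
  · obtain ⟨w, hwU, hwB, hwc⟩ := hAb
    obtain ⟨lo, hi, lo', hi', hxT, hyT, hcov, hwin, hnp⟩ := key w hwU hwB
    rw [memB] at hwB
    by_cases hBe : ∃ w ∈ U, w ∈ B ∧ w.2 < Y
    · obtain ⟨v, hvU, hvB, hvc⟩ := hBe
      obtain ⟨lo₂, hi₂, lo₂', hi₂', hxT₂, hyT₂, hcov₂, hvin, hnp₂⟩ := key v hvU hvB
      rw [memB] at hvB
      refine Layout.halfV 1 (X + 1) x₂ (Or.inl rfl) (fun x => by unfold Side; omega) (by omega)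
        ⟨by omega, by omega⟩ (by unfold Side; omega) (fun z hz => ⟨fun hzU => ?_, fun h1 => ?_⟩)
      · have := hRi z hzU hz; unfold SideW; omega
      · unfold SideW at h1; rw [memB] at hz
        by_cases hzY : Y ≤ z.2
        · exact hcov z (by omega) (by omega) (by omega) (by omega) hz.1 hz.2.1 hz.2.2.1 hz.2.2.2
        · exact hcov₂ z (by omega) (by omega) (by omega) (by omega) hz.1 hz.2.1 hz.2.2.1 hz.2.2.2
    · push Not at hBe
      by_cases hY4 : y₁ + 4 ≤ Y
      · refine Layout.ell (-1) 1 (X + 1) x₂ y₁ (Y - 1) (Or.inr rfl) (Or.inl rfl)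
          (fun x => by unfold Side; omega) (fun y => by unfold Side; omega) (by omega) (by omega)
          ⟨by omega, by omega⟩ ⟨by omega, by omega⟩ (fun z hz => ?_) (Or.inl (by unfold Side; omega))
        have hz' := (memB z).1 hz
        unfold SideW
        constructor
        · intro hzU; have := hRi z hzU hz; have := hBe z hzU hz; omega
        · intro h
          exact hcov z (by omega) (by omega) (by omega) (by omega) hz'.1 hz'.2.1 hz'.2.2.1 hz'.2.2.2
      · refine Layout.halfV 1 (X + 1) x₂ (Or.inl rfl) (fun x => by unfold Side; omega) (by omega)
          ⟨by omega, by omega⟩ (by unfold Side; omega) (fun z hz => ⟨fun hzU => ?_, fun h1 => ?_⟩)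
        · have := hRi z hzU hz; unfold SideW; omega
        · unfold SideW at h1; rw [memB] at hz
          exact hcov z (by omega) (by omega) (by omega) (by omega) hz.1 hz.2.1 hz.2.2.1 hz.2.2.2
  · push Not at hAb
    by_cases hne : ∃ w ∈ U, w ∈ B
    · obtain ⟨w, hwU, hwB⟩ := hne
      obtain ⟨lo, hi, lo', hi', hxT, hyT, hcov, hwin, hnp⟩ := key w hwU hwB
      rw [memB] at hwB
      have hc₂ := mk hcov w.1 hi' (by omega) (by omega) (by omega) le_rfl (by omega) (by omega) (by omega)
        (by omega)
      have h₂ := hAb _ hc₂.1 hc₂.2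
      simp only at h₂
      refine Layout.ell (-1) (-1) (X + 1) x₂ (Y + 1) y₂ (Or.inr rfl) (Or.inr rfl)
        (fun x => by unfold Side; omega) (fun y => by unfold Side; omega) (by omega) (by omega)
        ⟨by omega, by omega⟩ ⟨by omega, by omega⟩ (fun z hz => ?_) (Or.inl (by unfold Side; omega))
      have hz' := (memB z).1 hz
      unfold SideW
      constructor
      · intro hzU; have := hRi z hzU hz; have := hAb z hzU hz; omega
      · intro h
        exact hcov z (by omega) (by omega) (by omega) (by omega) hz'.1 hz'.2.1 hz'.2.2.1 hz'.2.2.2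
    · push Not at hne
      exact Layout.clear fun z hz hzU => hne z hzU hz

/-- Position `NE` of `p` (position NE: `X < p.1`, `Y < p.2`; a tile missing `p` has `hi = X` or `hi' = Y`). [cite: NewmanTassionWu2017, §3.5 (proof of Lemma 3.16)] -/
theorem layout_NE (hF : IsFrame n p x₁ x₂ y₁ y₂ X Y) (hW : IsFrameND n x₁ x₂ y₁ X Y)
    (hC : ∀ c ∈ C, LatCentre n c) (hpU : p ∉ tileUnion C) (hpx : X < p.1) (hpy : Y < p.2) :
    Layout x₁ x₂ y₁ y₂ X Y (tileUnion C) p := by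
  set U := tileUnion C with hU
  set B := boxR x₁ x₂ y₁ y₂ with hBdef
  have hFc := hF
  obtain ⟨fx₁, fx₂, fy₁, fy₂, fpx₁, fpx₂, fpy₁, fpy₂, fbx₁, fbx₂, fby₁, fby₂, fdx₁, fdx₂, fdy₁, fdy₂, hX, hY,
    hXle, hYle, -, -⟩ := hFc
  have hwx : x₁ + 8 ≤ x₂ := by omega
  have hwy : y₁ + 8 ≤ y₂ := by omega
  have key := layout_key hF hW hC hpU
  have memB : ∀ z : ℤ × ℤ, z ∈ B ↔ x₁ ≤ z.1 ∧ z.1 ≤ x₂ ∧ y₁ ≤ z.2 ∧ z.2 ≤ y₂ := fun z => by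
    rw [hBdef, mem_boxR_iff]
  have mk : ∀ {lo hi lo' hi' : ℤ},
      (∀ z : ℤ × ℤ, lo ≤ z.1 → z.1 ≤ hi → lo' ≤ z.2 → z.2 ≤ hi' → x₁ ≤ z.1 → z.1 ≤ x₂ → y₁ ≤ z.2 →
        z.2 ≤ y₂ → z ∈ U) →
      ∀ a b : ℤ, lo ≤ a → a ≤ hi → lo' ≤ b → b ≤ hi' → x₁ ≤ a → a ≤ x₂ → y₁ ≤ b → b ≤ y₂ →
        ((a, b) ∈ U ∧ (a, b) ∈ B) := by
    intro lo hi lo' hi' h a b h1 h2 h3 h4 h5 h6 h7 h8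
    exact ⟨h (a, b) h1 h2 h3 h4 h5 h6 h7 h8, (memB _).2 ⟨h5, h6, h7, h8⟩⟩
  by_cases hAb : ∃ w ∈ U, w ∈ B ∧ Y < w.2
  · obtain ⟨w, hwU, hwB, hwc⟩ := hAb
    obtain ⟨lo, hi, lo', hi', hxT, hyT, hcov, hwin, hnp⟩ := key w hwU hwB
    rw [memB] at hwB
    by_cases hRi : ∃ w ∈ U, w ∈ B ∧ X < w.1
    · obtain ⟨v, hvU, hvB, hvc⟩ := hRi
      obtain ⟨lo₂, hi₂, lo₂', hi₂', hxT₂, hyT₂, hcov₂, hvin, hnp₂⟩ := key v hvU hvB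
      rw [memB] at hvB
      refine Layout.quad 1 1 (X + 1) x₂ (Y + 1) y₂ (Or.inl rfl) (Or.inl rfl)
        (fun x => by unfold Side; omega) (fun y => by unfold Side; omega) (by omega) (by omega)
        ⟨by omega, by omega⟩ ⟨by omega, by omega⟩ ⟨by unfold Side; omega, by unfold Side; omega⟩
        (fun z hz h1 h2 hzU => ?_) (fun z hz h1 h2 => ?_) (fun z hz h1 h2 => ?_)
      · obtain ⟨lo₃, hi₃, lo₃', hi₃', hxT₃, hyT₃, -, hzin, hnp₃⟩ := key z hzU hz
        rw [memB] at hz; unfold Side at h1 h2; omega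
      · rw [memB] at hz; unfold SideW at h1 h2
        exact hcov z (by omega) (by omega) (by omega) (by omega) hz.1 hz.2.1 hz.2.2.1 hz.2.2.2
      · rw [memB] at hz; unfold SideW at h1 h2
        exact hcov₂ z (by omega) (by omega) (by omega) (by omega) hz.1 hz.2.1 hz.2.2.1 hz.2.2.2
    · push Not at hRi
      by_cases hBe : ∃ w ∈ U, w ∈ B ∧ w.2 < Y
      · obtain ⟨v, hvU, hvB, hvc⟩ := hBe
        obtain ⟨lo₂, hi₂, lo₂', hi₂', hxT₂, hyT₂, hcov₂, hvin, hnp₂⟩ := key v hvU hvB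
        rw [memB] at hvB
        have hc₂ := mk hcov₂ hi₂ v.2 (by omega) le_rfl (by omega) (by omega) (by omega) (by omega) (by omega)
          (by omega)
        have hhi₂ := hRi _ hc₂.1 hc₂.2
        simp only at hhi₂
        refine Layout.halfV 1 (X + 1) x₂ (Or.inl rfl) (fun x => by unfold Side; omega) (by omega)
          ⟨by omega, by omega⟩ (by unfold Side; omega) (fun z hz => ⟨fun hzU => ?_, fun h1 => ?_⟩)
        · have := hRi z hzU hz; unfold SideW; omega
        · unfold SideW at h1; rw [memB] at hz
          by_cases hzY : Y ≤ z.2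
          · exact hcov z (by omega) (by omega) (by omega) (by omega) hz.1 hz.2.1 hz.2.2.1 hz.2.2.2
          · exact hcov₂ z (by omega) (by omega) (by omega) (by omega) hz.1 hz.2.1 hz.2.2.1 hz.2.2.2
      · push Not at hBe
        by_cases hY4 : y₁ + 4 ≤ Y
        · refine Layout.ell (-1) 1 (X + 1) x₂ y₁ (Y - 1) (Or.inr rfl) (Or.inl rfl)
            (fun x => by unfold Side; omega) (fun y => by unfold Side; omega) (by omega) (by omega)
            ⟨by omega, by omega⟩ ⟨by omega, by omega⟩ (fun z hz => ?_) (Or.inl (by unfold Side; omega))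
          have hz' := (memB z).1 hz
          unfold SideW
          constructor
          · intro hzU; have := hRi z hzU hz; have := hBe z hzU hz; omega
          · intro h
            exact hcov z (by omega) (by omega) (by omega) (by omega) hz'.1 hz'.2.1 hz'.2.2.1 hz'.2.2.2
        · refine Layout.halfV 1 (X + 1) x₂ (Or.inl rfl) (fun x => by unfold Side; omega) (by omega)
            ⟨by omega, by omega⟩ (by unfold Side; omega) (fun z hz => ⟨fun hzU => ?_, fun h1 => ?_⟩)
          · have := hRi z hzU hz; unfold SideW; omega
          · unfold SideW at h1; rw [memB] at hz
            exact hcov z (by omega) (by omega) (by omega) (by omega) hz.1 hz.2.1 hz.2.2.1 hz.2.2.2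
  · push Not at hAb
    by_cases hRi : ∃ w ∈ U, w ∈ B ∧ X < w.1
    · obtain ⟨v, hvU, hvB, hvc⟩ := hRi
      obtain ⟨lo₂, hi₂, lo₂', hi₂', hxT₂, hyT₂, hcov₂, hvin, hnp₂⟩ := key v hvU hvB
      rw [memB] at hvB
      by_cases hLe : ∃ w ∈ U, w ∈ B ∧ w.1 < X
      · obtain ⟨u, huU, huB, huc⟩ := hLe
        obtain ⟨lo₃, hi₃, lo₃', hi₃', hxT₃, hyT₃, hcov₃, huin, hnp₃⟩ := key u huU huB
        rw [memB] at huB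
        have hc₃ := mk hcov₃ u.1 hi₃' (by omega) (by omega) (by omega) le_rfl (by omega) (by omega) (by omega)
          (by omega)
        have hhi₃ := hAb _ hc₃.1 hc₃.2
        simp only at hhi₃
        refine Layout.halfH 1 (Y + 1) y₂ (Or.inl rfl) (fun y => by unfold Side; omega) (by omega)
          ⟨by omega, by omega⟩ (by unfold Side; omega) (fun z hz => ⟨fun hzU => ?_, fun h1 => ?_⟩)
        · have := hAb z hzU hz; unfold SideW; omega
        · unfold SideW at h1; rw [memB] at hz
          by_cases hzX : X ≤ z.1
          · exact hcov₂ z (by omega) (by omega) (by omega) (by omega) hz.1 hz.2.1 hz.2.2.1 hz.2.2.2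
          · exact hcov₃ z (by omega) (by omega) (by omega) (by omega) hz.1 hz.2.1 hz.2.2.1 hz.2.2.2
      · push Not at hLe
        have hc₂ := mk hcov₂ lo₂ v.2 le_rfl (by omega) (by omega) (by omega) (by omega) (by omega) (by omega)
          (by omega)
        have hlo₂ := hLe _ hc₂.1 hc₂.2
        simp only at hlo₂
        by_cases hX4 : x₁ + 4 ≤ X
        · refine Layout.ell 1 (-1) x₁ (X - 1) (Y + 1) y₂ (Or.inl rfl) (Or.inr rfl)
            (fun x => by unfold Side; omega) (fun y => by unfold Side; omega) (by omega) (by omega)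
            ⟨by omega, by omega⟩ ⟨by omega, by omega⟩ (fun z hz => ?_) (Or.inr (by unfold Side; omega))
          have hz' := (memB z).1 hz
          unfold SideW
          constructor
          · intro hzU; have := hLe z hzU hz; have := hAb z hzU hz; omega
          · intro h
            exact hcov₂ z (by omega) (by omega) (by omega) (by omega) hz'.1 hz'.2.1 hz'.2.2.1 hz'.2.2.2
        · refine Layout.halfH 1 (Y + 1) y₂ (Or.inl rfl) (fun y => by unfold Side; omega) (by omega)
            ⟨by omega, by omega⟩ (by unfold Side; omega) (fun z hz => ⟨fun hzU => ?_, fun h1 => ?_⟩)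
          · have := hAb z hzU hz; unfold SideW; omega
          · unfold SideW at h1; rw [memB] at hz
            exact hcov₂ z (by omega) (by omega) (by omega) (by omega) hz.1 hz.2.1 hz.2.2.1 hz.2.2.2
    · push Not at hRi
      by_cases hne : ∃ w ∈ U, w ∈ B
      · obtain ⟨w, hwU, hwB⟩ := hne
        obtain ⟨lo, hi, lo', hi', hxT, hyT, hcov, hwin, hnp⟩ := key w hwU hwB
        rw [memB] at hwB
        have hc := mk hcov hi w.2 (by omega) le_rfl (by omega) (by omega) (by omega) (by omega) (by omega)
          (by omega)
        have hhi := hRi _ hc.1 hc.2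
        have hc' := mk hcov w.1 hi' (by omega) (by omega) (by omega) le_rfl (by omega) (by omega) (by omega)
          (by omega)
        have hhi' := hAb _ hc'.1 hc'.2
        simp only at hhi hhi'
        refine Layout.ell (-1) (-1) (X + 1) x₂ (Y + 1) y₂ (Or.inr rfl) (Or.inr rfl)
          (fun x => by unfold Side; omega) (fun y => by unfold Side; omega) (by omega) (by omega)
          ⟨by omega, by omega⟩ ⟨by omega, by omega⟩ (fun z hz => ?_) (Or.inl (by unfold Side; omega))
        have hz' := (memB z).1 hz
        unfold SideW
        constructor
        · intro hzU; have := hRi z hzU hz; have := hAb z hzU hz; omega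
        · intro h
          exact hcov z (by omega) (by omega) (by omega) (by omega) hz'.1 hz'.2.1 hz'.2.2.1 hz'.2.2.2
      · push Not at hne
        exact Layout.clear fun z hz hzU => hne z hzU hz

/-- **Classification of the free part of a frame.** For a frame of `p` and a union `U` of lattice
tiles with `p ∉ U`, one of the five layouts holds.
[cite: NewmanTassionWu2017, §3.5 (proof of Lemma 3.16, "the domain K_□ is regular enough to apply Theorem 3.6")] -/
theorem layout_of_frame (hF : IsFrame n p x₁ x₂ y₁ y₂ X Y) (hW : IsFrameND n x₁ x₂ y₁ X Y)
    (hC : ∀ c ∈ C, LatCentre n c) (hpU : p ∉ tileUnion C) : Layout x₁ x₂ y₁ y₂ X Y (tileUnion C) p := by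
  rcases lt_trichotomy p.1 X with hpx | hpx | hpx <;> rcases lt_trichotomy p.2 Y with hpy | hpy | hpy
  · exact layout_SW hF hW hC hpU hpx hpy
  · exact layout_W hF hW hC hpU hpx hpy
  · exact layout_NW hF hW hC hpU hpx hpy
  · exact layout_S hF hW hC hpU hpx hpy
  · exact layout_C hF hW hC hpU hpx hpy
  · exact layout_N hF hW hC hpU hpx hpy
  · exact layout_SE hF hW hC hpU hpx hpy
  · exact layout_E hF hW hC hpU hpx hpy
  · exact layout_NE hF hW hC hpU hpx hpy

end Classify

end NTW17

end Literature.Probability.Percolation
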